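import Literature.Algebra.Polynomial.FischerInnerProduct
import Mathlib.RingTheory.GradedAlgebra.Homogeneous.Ideal
import Mathlib.LinearAlgebra.BilinearForm.Orthogonal
import Mathlib.LinearAlgebra.FiniteDimensional.Lemmas
import HarnessLib

/-!
# The Fischer decomposition `𝒫ᵏ = ℋᵏ ⊕ (𝒫·S)ᵏ` (Goodman–Wallach, Lemma 5.1.5)

Goodman–Wallach, *Symmetry, Representations, and Invariants* (GTM 255), § 5.1.2, Lemma 5.1.5 and
its proof [GoodmanWallachGTM255]. Let `𝒫 = ℝ[x_ι]` and let `f ↦ ∂(f)` be the algebra homomorphism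
from `𝒫` to (constant-coefficient) differential operators with `∂(xᵢ) = ∂/∂xᵢ` (passed below as a
hypothesis `D : 𝒫 →ₐ[ℝ] End_ℝ 𝒫`, `hD : D (X i) = ∂ᵢ`). For a set `S ⊆ 𝒫` a polynomial `h` is
*`S`-harmonic* if `∂(g) h = 0` for all `g ∈ S` (the book takes `S = 𝒥₊`, the `𝔖ₙ`-invariants without
constant term; § 5.6.4 takes `S = {r²}`); the harmonics form the `ℝ`-subspace
`⨅ g ∈ S, ker (D g)`, and `𝒫S = Ideal.span S` is the ideal generated by `S`.

With the Fischer inner product `⟨p, q⟩ = ∑_α α! p_α q_α` of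
`Literature.Algebra.Polynomial.FischerInnerProduct` (real coefficients, so the book's conjugation
`g*` is the identity) we prove, following the printed proof verbatim:

* `exists_algHom_pderiv`, `algHom_pderiv_unique` — the homomorphism `f ↦ ∂(f)` exists and is
  unique;
* `fischerInner_self_eq_zero_iff` — the form is positive definite;
* `fischerInner_apply_right` — `⟨f | ∂(g) h⟩ = ⟨f g | h⟩`;
* `fischerInner_eq_zero_of_isHomogeneous_of_ne` — `⟨𝒫ʲ | 𝒫ᵏ⟩ = 0` for `j ≠ k`;
* `forall_apply_eq_zero_iff_forall_mem_span` — `h` is `S`-harmonic iff `⟨f g | h⟩ = 0` for all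
  `f ∈ 𝒫`, `g ∈ S`, i.e. iff `h ⊥ 𝒫S`; `forall_apply_eq_zero_iff_of_isHomogeneous` — for `S`
  homogeneous and `h ∈ 𝒫ᵏ` it suffices to test `q ∈ (𝒫S)ᵏ` ("`ℋᵏ` is the orthogonal complement of
  `(𝒫S)ᵏ` in `𝒫ᵏ`");
* **Lemma 5.1.5** `homogeneousSubmodule_eq_harmonic_sup_span` and `disjoint_harmonic_span` —
  `𝒫ᵏ = ℋᵏ ⊕ (𝒫S)ᵏ` for every `k` and every set `S` of homogeneous polynomials; the elementwise
  form `exists_harmonic_add_mem_span`, and the dimension count `finrank_harmonic_add_finrank_span`.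

The book states the lemma for `S = 𝒥₊` (symmetric group); its proof uses only that `S` consists of
homogeneous polynomials, which is the generality formalised here (so it also covers the
`O(n)`-harmonics of § 5.6.4, `S = {∑ xᵢ²}`, over `ℝ`).

References: R. Goodman, N. R. Wallach, GTM 255, Springer 2009, § 5.1.2, Lemma 5.1.5
[GoodmanWallachGTM255]; E. Fischer, J. reine angew. Math. 148 (1918).
-/

open MvPolynomial
open scoped BigOperators

namespace Literature.Algebra.Polynomial.FischerDecomposition

noncomputable section

variable {ι : Type*} [Fintype ι] [DecidableEq ι]

/-! ## § 0. The homomorphism `f ↦ ∂(f)` -/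

omit [Fintype ι] in
open scoped IsMulCommutative in
/-- **The map `f ↦ ∂(f)` exists**: there is an algebra homomorphism `D` from `𝒫` to the
(constant-coefficient) differential operators on `𝒫` with `D(xᵢ) = ∂/∂xᵢ` (the `∂ᵢ` commute, so
`D` factors through the commutative algebra they generate).
[cite: GoodmanWallachGTM255, §5.1.2 ("The map f ↦ ∂(f) is an algebra homomorphism … uniquely determined by the property that ∂(xᵢ) = ∂/∂xᵢ")] -/
theorem exists_algHom_pderiv :
    ∃ D : MvPolynomial ι ℝ →ₐ[ℝ] Module.End ℝ (MvPolynomial ι ℝ),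
      ∀ i, D (X i) =
        ((pderiv i : Derivation ℝ (MvPolynomial ι ℝ) (MvPolynomial ι ℝ)) :
          Module.End ℝ (MvPolynomial ι ℝ)) := by
  set s : Set (Module.End ℝ (MvPolynomial ι ℝ)) := Set.range fun i : ι =>
    ((pderiv i : Derivation ℝ (MvPolynomial ι ℝ) (MvPolynomial ι ℝ)) :
      Module.End ℝ (MvPolynomial ι ℝ)) with hs
  have hcomm : ∀ a ∈ s, ∀ b ∈ s, a * b = b * a := by
    rintro _ ⟨i, rfl⟩ _ ⟨j, rfl⟩
    refine LinearMap.ext fun p => ?_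
    simp only [Module.End.mul_apply, Derivation.coeFn_coe]
    exact pderiv_pderiv_comm i j p
  haveI := Algebra.isMulCommutative_adjoin ℝ hcomm
  let φ : MvPolynomial ι ℝ →ₐ[ℝ] Algebra.adjoin ℝ s :=
    MvPolynomial.aeval fun i => (⟨_, Algebra.subset_adjoin ⟨i, rfl⟩⟩ : Algebra.adjoin ℝ s)
  refine ⟨(Algebra.adjoin ℝ s).val.comp φ, fun i => ?_⟩
  rw [AlgHom.comp_apply, MvPolynomial.aeval_X]
  rfl

omit [Fintype ι] [DecidableEq ι] in
/-- … and it is **unique**. [cite: GoodmanWallachGTM255, §5.1.2 (same sentence)] -/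
theorem algHom_pderiv_unique (D D' : MvPolynomial ι ℝ →ₐ[ℝ] Module.End ℝ (MvPolynomial ι ℝ))
    (hD : ∀ i, D (X i) =
      ((pderiv i : Derivation ℝ (MvPolynomial ι ℝ) (MvPolynomial ι ℝ)) :
        Module.End ℝ (MvPolynomial ι ℝ)))
    (hD' : ∀ i, D' (X i) =
      ((pderiv i : Derivation ℝ (MvPolynomial ι ℝ) (MvPolynomial ι ℝ)) :
        Module.End ℝ (MvPolynomial ι ℝ))) : D = D' :=
  MvPolynomial.algHom_ext fun i => by rw [hD, hD']

/-! ## § 1. Positive definiteness -/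

/-- The Fischer form is positive definite: `⟨p | p⟩ = 0 ↔ p = 0`.
[cite: GoodmanWallachGTM255, Lemma 5.1.5 (proof: "the form ⟨f | g⟩ is … positive definite")] -/
theorem fischerInner_self_eq_zero_iff (p : MvPolynomial ι ℝ) : fischerInner p p = 0 ↔ p = 0 := by
  refine ⟨fun h => ?_, fun h => by rw [h, fischerInner_zero_left]⟩
  rw [fischerInner_self_eq] at h
  have hterm : ∀ α ∈ p.support, mfactorial α * coeff α p ^ 2 = 0 :=
    (Finset.sum_eq_zero_iff_of_nonneg fun α _ =>
      mul_nonneg (mfactorial_pos α).le (sq_nonneg _)).mp h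
  ext α
  rw [coeff_zero]
  by_contra hα
  have hmem : α ∈ p.support := mem_support_iff.mpr hα
  have := hterm α hmem
  rcases mul_eq_zero.mp this with h1 | h2
  · exact absurd h1 (mfactorial_pos α).ne'
  · exact hα (pow_eq_zero_iff (two_ne_zero) |>.mp h2)

/-! ## § 2. Adjointness `⟨f | ∂(g) h⟩ = ⟨f g | h⟩` -/

/-- **Adjointness of `∂(g)` and multiplication by `g`**: `⟨f | ∂(g) h⟩ = ⟨f g | h⟩` (real
coefficients). [cite: GoodmanWallachGTM255, Lemma 5.1.5 (proof, display "⟨f | ∂(g)h⟩ = ⟨fg* | h⟩")] -/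
theorem fischerInner_apply_right (D : MvPolynomial ι ℝ →ₐ[ℝ] Module.End ℝ (MvPolynomial ι ℝ))
    (hD : ∀ i, D (X i) =
      ((pderiv i : Derivation ℝ (MvPolynomial ι ℝ) (MvPolynomial ι ℝ)) :
        Module.End ℝ (MvPolynomial ι ℝ)))
    (f g h : MvPolynomial ι ℝ) : fischerInner f (D g h) = fischerInner (f * g) h := by
  induction g using MvPolynomial.induction_on generalizing h with
  | C a =>
    have e1 : D (C a) h = a • h := by
      rw [← MvPolynomial.algebraMap_eq, AlgHom.commutes, Module.algebraMap_end_apply]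
    rw [e1, fischerInner_smul_right, show f * C a = a • f by rw [mul_comm, C_mul'],
      fischerInner_smul_left]
  | add p q hp hq =>
    rw [map_add, LinearMap.add_apply, fischerInner_add_right, hp, hq, mul_add,
      fischerInner_add_left]
  | mul_X p i hp =>
    have hDX : ∀ h' : MvPolynomial ι ℝ, D (X i) h' = pderiv i h' := fun h' => by rw [hD]; rfl
    rw [map_mul, Module.End.mul_apply, hDX, hp, fischerInner_pderiv_right]
    congr 1
    ring

/-! ## § 3. Orthogonality of distinct degrees -/

/-- `⟨𝒫ʲ | 𝒫ᵏ⟩ = 0` for `j ≠ k`. [cite: GoodmanWallachGTM255, Lemma 5.1.5 (proof)] -/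
theorem fischerInner_eq_zero_of_isHomogeneous_of_ne {p q : MvPolynomial ι ℝ} {m n : ℕ}
    (hp : p.IsHomogeneous m) (hq : q.IsHomogeneous n) (hmn : m ≠ n) : fischerInner p q = 0 := by
  rw [fischerInner_eq_sum_of_subset (subset_refl _)]
  refine Finset.sum_eq_zero fun α _ => ?_
  by_cases hα : coeff α p = 0
  · rw [hα, zero_mul, mul_zero]
  · have hdeg : α.degree = m := by
      by_contra hne
      exact hα (hp.coeff_eq_zero hne)
    rw [hq.coeff_eq_zero (by rw [hdeg]; exact hmn), mul_zero, mul_zero]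

omit [DecidableEq ι] in
/-- A homogeneous polynomial pairs with `q` only through the homogeneous component of `q` of its
own degree. [folklore] -/
private theorem fischerInner_eq_homogeneousComponent [DecidableEq ι] {h : MvPolynomial ι ℝ} {k : ℕ}
    (hh : h.IsHomogeneous k) (q : MvPolynomial ι ℝ) :
    fischerInner q h = fischerInner (homogeneousComponent k q) h := by
  conv_lhs => rw [← sum_homogeneousComponent q]
  rw [fischerInner_sum_left, Finset.sum_eq_single k]
  · intro i _ hik
    exact fischerInner_eq_zero_of_isHomogeneous_of_ne (homogeneousComponent_isHomogeneous i q) hh hik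
  · intro hk
    rw [Finset.mem_range, not_lt] at hk
    rw [homogeneousComponent_eq_zero k q (by omega), fischerInner_zero_left]

/-! ## § 4. Harmonic `⟺` orthogonal to the ideal `𝒫S` -/

/-- **`h` is `S`-harmonic iff `h ⊥ 𝒫S`**: `∂(g)h = 0` for all `g ∈ S` if and only if
`⟨q | h⟩ = 0` for all `q` in the ideal generated by `S` ("`h ∈ ℋ` iff `⟨fg | h⟩ = 0` for all
`f ∈ 𝒫` and all `g`"). [cite: GoodmanWallachGTM255, Lemma 5.1.5 (proof)] -/
theorem forall_apply_eq_zero_iff_forall_mem_span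
    (D : MvPolynomial ι ℝ →ₐ[ℝ] Module.End ℝ (MvPolynomial ι ℝ))
    (hD : ∀ i, D (X i) =
      ((pderiv i : Derivation ℝ (MvPolynomial ι ℝ) (MvPolynomial ι ℝ)) :
        Module.End ℝ (MvPolynomial ι ℝ)))
    (S : Set (MvPolynomial ι ℝ)) (h : MvPolynomial ι ℝ) :
    (∀ g ∈ S, D g h = 0) ↔ ∀ q ∈ Ideal.span S, fischerInner q h = 0 := by
  constructor
  · intro hh q hq
    -- stronger invariant: `⟨f q | h⟩ = 0` for all `f`
    suffices key : ∀ f : MvPolynomial ι ℝ, fischerInner (f * q) h = 0 by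
      simpa using key 1
    induction hq using Submodule.span_induction with
    | mem g hg => intro f; rw [← fischerInner_apply_right D hD, hh g hg, fischerInner_zero_right]
    | zero => intro f; rw [mul_zero, fischerInner_zero_left]
    | add q₁ q₂ _ _ h₁ h₂ => intro f; rw [mul_add, fischerInner_add_left, h₁, h₂, add_zero]
    | smul r q _ hq' => intro f; rw [smul_eq_mul, ← mul_assoc]; exact hq' (f * r)
  · intro hh g hg
    rw [← fischerInner_self_eq_zero_iff, fischerInner_apply_right D hD]
    exact hh _ (Ideal.mul_mem_left _ _ (Ideal.subset_span hg))

omit [Fintype ι] [DecidableEq ι] in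
/-- The ideal generated by homogeneous polynomials contains the homogeneous components of its
members. [folklore] -/
private theorem homogeneousComponent_mem_span {S : Set (MvPolynomial ι ℝ)}
    (hS : ∀ g ∈ S, ∃ d, g.IsHomogeneous d) {q : MvPolynomial ι ℝ} (hq : q ∈ Ideal.span S)
    (k : ℕ) : homogeneousComponent k q ∈ Ideal.span S := by
  letI := MvPolynomial.gradedAlgebra (σ := ι) (R := ℝ)
  have hI : (Ideal.span S).IsHomogeneous (homogeneousSubmodule ι ℝ) :=
    Ideal.homogeneous_span _ _ fun g hg => by
      obtain ⟨d, hd⟩ := hS g hg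
      exact ⟨d, (mem_homogeneousSubmodule d g).mpr hd⟩
  have := (hI.mem_iff.mp hq) k
  rwa [show (DirectSum.decompose (homogeneousSubmodule ι ℝ) q k : MvPolynomial ι ℝ) =
      homogeneousComponent k q from decomposition.decompose'_apply q k] at this

/-- **`ℋᵏ` is the orthogonal complement of `(𝒫S)ᵏ` in `𝒫ᵏ`**: for `S` consisting of homogeneous
polynomials and `h ∈ 𝒫ᵏ`, `h` is `S`-harmonic iff `⟨q | h⟩ = 0` for all `q ∈ 𝒫S ∩ 𝒫ᵏ`.
[cite: GoodmanWallachGTM255, Lemma 5.1.5 (proof)] -/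
theorem forall_apply_eq_zero_iff_of_isHomogeneous
    (D : MvPolynomial ι ℝ →ₐ[ℝ] Module.End ℝ (MvPolynomial ι ℝ))
    (hD : ∀ i, D (X i) =
      ((pderiv i : Derivation ℝ (MvPolynomial ι ℝ) (MvPolynomial ι ℝ)) :
        Module.End ℝ (MvPolynomial ι ℝ)))
    {S : Set (MvPolynomial ι ℝ)} (hS : ∀ g ∈ S, ∃ d, g.IsHomogeneous d)
    {h : MvPolynomial ι ℝ} {k : ℕ} (hh : h.IsHomogeneous k) :
    (∀ g ∈ S, D g h = 0) ↔ ∀ q ∈ Ideal.span S, q.IsHomogeneous k → fischerInner q h = 0 := by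
  rw [forall_apply_eq_zero_iff_forall_mem_span D hD]
  refine ⟨fun H q hq _ => H q hq, fun H q hq => ?_⟩
  rw [fischerInner_eq_homogeneousComponent hh]
  exact H _ (homogeneousComponent_mem_span hS hq k) (homogeneousComponent_isHomogeneous k q)

/-! ## § 5. Lemma 5.1.5: `𝒫ᵏ = ℋᵏ ⊕ (𝒫S)ᵏ` -/

/-- `ℋ ∩ 𝒫S = 0`: a harmonic polynomial in the ideal is orthogonal to itself.
[cite: GoodmanWallachGTM255, Lemma 5.1.5] -/
theorem disjoint_harmonic_span (D : MvPolynomial ι ℝ →ₐ[ℝ] Module.End ℝ (MvPolynomial ι ℝ))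
    (hD : ∀ i, D (X i) =
      ((pderiv i : Derivation ℝ (MvPolynomial ι ℝ) (MvPolynomial ι ℝ)) :
        Module.End ℝ (MvPolynomial ι ℝ)))
    (S : Set (MvPolynomial ι ℝ)) :
    Disjoint (⨅ g ∈ S, LinearMap.ker (D g)) ((Ideal.span S).restrictScalars ℝ) := by
  rw [Submodule.disjoint_def]
  intro h hh hI
  have hh' : ∀ g ∈ S, D g h = 0 := by
    intro g hg
    have := (Submodule.mem_iInf _).mp hh g
    rw [Submodule.mem_iInf] at this
    exact this hg
  rw [← fischerInner_self_eq_zero_iff]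
  exact (forall_apply_eq_zero_iff_forall_mem_span D hD S h).mp hh' h hI

/-- **Lemma 5.1.5 (Fischer decomposition).** For every set `S` of homogeneous polynomials and
every degree `k`: `𝒫ᵏ = ℋᵏ + (𝒫S)ᵏ`, where `ℋ = {h : ∂(g)h = 0 ∀ g ∈ S}` and `𝒫S` is the ideal
generated by `S` (the sum is direct by `disjoint_harmonic_span`). Proof as printed: `𝒫ᵏ` is a
finite-dimensional space with the positive definite Fischer form, `ℋᵏ = ((𝒫S)ᵏ)^⊥`.
[cite: GoodmanWallachGTM255, Lemma 5.1.5] -/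
theorem homogeneousSubmodule_eq_harmonic_sup_span
    (D : MvPolynomial ι ℝ →ₐ[ℝ] Module.End ℝ (MvPolynomial ι ℝ))
    (hD : ∀ i, D (X i) =
      ((pderiv i : Derivation ℝ (MvPolynomial ι ℝ) (MvPolynomial ι ℝ)) :
        Module.End ℝ (MvPolynomial ι ℝ)))
    {S : Set (MvPolynomial ι ℝ)} (hS : ∀ g ∈ S, ∃ d, g.IsHomogeneous d) (k : ℕ) :
    homogeneousSubmodule ι ℝ k =
      (homogeneousSubmodule ι ℝ k ⊓ ⨅ g ∈ S, LinearMap.ker (D g)) ⊔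
        (homogeneousSubmodule ι ℝ k ⊓ (Ideal.span S).restrictScalars ℝ) := by
  set Pk := homogeneousSubmodule ι ℝ k with hPk
  haveI : FiniteDimensional ℝ Pk := Module.Finite.iff_fg.mpr (homogeneousSubmodule_fg ι ℝ k)
  -- the Fischer form on `𝒫ᵏ`
  let B : LinearMap.BilinForm ℝ Pk := LinearMap.mk₂ ℝ
    (fun v w : Pk => fischerInner (v : MvPolynomial ι ℝ) (w : MvPolynomial ι ℝ))
    (fun _ _ _ => by simp only [Submodule.coe_add, fischerInner_add_left])
    (fun _ _ _ => by simp only [Submodule.coe_smul, fischerInner_smul_left, smul_eq_mul])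
    (fun _ _ _ => by simp only [Submodule.coe_add, fischerInner_add_right])
    (fun _ _ _ => by simp only [Submodule.coe_smul, fischerInner_smul_right, smul_eq_mul])
  have hB : ∀ v w : Pk, B v w = fischerInner (v : MvPolynomial ι ℝ) (w : MvPolynomial ι ℝ) :=
    fun v w => rfl
  have hrefl : B.IsRefl := fun v w h0 => by rw [hB] at h0 ⊢; rwa [fischerInner_comm]
  let W : Submodule ℝ Pk := ((Ideal.span S).restrictScalars ℝ).comap Pk.subtype
  have hdisj : Disjoint W (B.orthogonal W) := by
    rw [Submodule.disjoint_def]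
    intro v hv hv'
    have h0 : B v v = 0 := (LinearMap.BilinForm.mem_orthogonal_iff.mp hv') v hv
    rw [hB, fischerInner_self_eq_zero_iff] at h0
    exact Subtype.ext h0
  have hcompl : IsCompl W (B.orthogonal W) :=
    (LinearMap.BilinForm.isCompl_orthogonal_iff_disjoint hrefl).mpr hdisj
  refine le_antisymm ?_ (sup_le inf_le_left inf_le_left)
  intro f hf
  have hmem : (⟨f, hf⟩ : Pk) ∈ W ⊔ B.orthogonal W := by
    rw [hcompl.sup_eq_top]; exact Submodule.mem_top
  obtain ⟨w, hw, u, hu, hwu⟩ := Submodule.mem_sup.mp hmem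
  have hfwu : f = (u : MvPolynomial ι ℝ) + (w : MvPolynomial ι ℝ) := by
    rw [add_comm, ← Submodule.coe_add, hwu]
  rw [hfwu]
  refine Submodule.add_mem_sup ⟨u.2, ?_⟩ ⟨w.2, hw⟩
  -- `u ∈ ((𝒫S)ᵏ)^⊥` is harmonic
  have hu' : ∀ g ∈ S, D g (u : MvPolynomial ι ℝ) = 0 := by
    rw [forall_apply_eq_zero_iff_of_isHomogeneous D hD hS ((mem_homogeneousSubmodule k _).mp u.2)]
    intro q hq hqk
    have hqW : (⟨q, (mem_homogeneousSubmodule k q).mpr hqk⟩ : Pk) ∈ W := hq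
    have := (LinearMap.BilinForm.mem_orthogonal_iff.mp hu) _ hqW
    rwa [hB] at this
  simp only [SetLike.mem_coe, Submodule.mem_iInf, LinearMap.mem_ker]
  exact hu'

/-- **Lemma 5.1.5, elementwise**: every `f ∈ 𝒫ᵏ` is `f = h + q` with `h ∈ ℋᵏ` harmonic and
`q ∈ 𝒫S ∩ 𝒫ᵏ`. [cite: GoodmanWallachGTM255, Lemma 5.1.5] -/
theorem exists_harmonic_add_mem_span (D : MvPolynomial ι ℝ →ₐ[ℝ] Module.End ℝ (MvPolynomial ι ℝ))
    (hD : ∀ i, D (X i) =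
      ((pderiv i : Derivation ℝ (MvPolynomial ι ℝ) (MvPolynomial ι ℝ)) :
        Module.End ℝ (MvPolynomial ι ℝ)))
    {S : Set (MvPolynomial ι ℝ)} (hS : ∀ g ∈ S, ∃ d, g.IsHomogeneous d) {k : ℕ}
    {f : MvPolynomial ι ℝ} (hf : f.IsHomogeneous k) :
    ∃ h q : MvPolynomial ι ℝ, h.IsHomogeneous k ∧ (∀ g ∈ S, D g h = 0) ∧ q.IsHomogeneous k ∧
      q ∈ Ideal.span S ∧ f = h + q := by
  have hf' : f ∈ homogeneousSubmodule ι ℝ k := (mem_homogeneousSubmodule k f).mpr hf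
  rw [homogeneousSubmodule_eq_harmonic_sup_span D hD hS k] at hf'
  obtain ⟨h, ⟨hh1, hh2⟩, q, ⟨hq1, hq2⟩, rfl⟩ := Submodule.mem_sup.mp hf'
  refine ⟨h, q, (mem_homogeneousSubmodule k h).mp hh1, fun g hg => ?_,
    (mem_homogeneousSubmodule k q).mp hq1, hq2, rfl⟩
  have := (Submodule.mem_iInf _).mp hh2 g
  rw [Submodule.mem_iInf] at this
  exact this hg

/-- **Lemma 5.1.5, dimensions**: `dim ℋᵏ + dim (𝒫S)ᵏ = dim 𝒫ᵏ` (the graded identity behind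
Corollary 5.1.7). [cite: GoodmanWallachGTM255, Lemma 5.1.5 / Corollary 5.1.7 (proof)] -/
theorem finrank_harmonic_add_finrank_span
    (D : MvPolynomial ι ℝ →ₐ[ℝ] Module.End ℝ (MvPolynomial ι ℝ))
    (hD : ∀ i, D (X i) =
      ((pderiv i : Derivation ℝ (MvPolynomial ι ℝ) (MvPolynomial ι ℝ)) :
        Module.End ℝ (MvPolynomial ι ℝ)))
    {S : Set (MvPolynomial ι ℝ)} (hS : ∀ g ∈ S, ∃ d, g.IsHomogeneous d) (k : ℕ) :
    Module.finrank ℝ ↥(homogeneousSubmodule ι ℝ k ⊓ ⨅ g ∈ S, LinearMap.ker (D g)) +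
        Module.finrank ℝ ↥(homogeneousSubmodule ι ℝ k ⊓ (Ideal.span S).restrictScalars ℝ) =
      Module.finrank ℝ ↥(homogeneousSubmodule ι ℝ k) := by
  haveI : Module.Finite ℝ (homogeneousSubmodule ι ℝ k) :=
    Module.Finite.iff_fg.mpr (homogeneousSubmodule_fg ι ℝ k)
  haveI : Module.Finite ℝ ↥(homogeneousSubmodule ι ℝ k ⊓ ⨅ g ∈ S, LinearMap.ker (D g)) :=
    FiniteDimensional.of_injective (Submodule.inclusion inf_le_left) (Submodule.inclusion_injective _)
  haveI : Module.Finite ℝ ↥(homogeneousSubmodule ι ℝ k ⊓ (Ideal.span S).restrictScalars ℝ) :=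
    FiniteDimensional.of_injective (Submodule.inclusion inf_le_left) (Submodule.inclusion_injective _)
  have hinf : (homogeneousSubmodule ι ℝ k ⊓ ⨅ g ∈ S, LinearMap.ker (D g)) ⊓
      (homogeneousSubmodule ι ℝ k ⊓ (Ideal.span S).restrictScalars ℝ) = ⊥ :=
    disjoint_iff.mp (((disjoint_harmonic_span D hD S).mono_left inf_le_right).mono_right
      inf_le_right)
  have h1 := Submodule.finrank_sup_add_finrank_inf_eq
    (homogeneousSubmodule ι ℝ k ⊓ ⨅ g ∈ S, LinearMap.ker (D g))
    (homogeneousSubmodule ι ℝ k ⊓ (Ideal.span S).restrictScalars ℝ)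
  rw [hinf, finrank_bot, add_zero, ← homogeneousSubmodule_eq_harmonic_sup_span D hD hS k] at h1
  exact h1.symm

end

end Literature.Algebra.Polynomial.FischerDecomposition
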